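import Summits.AtomisticToContinuum.HydrodynamicLimit.Theorems.OneFlightGossipEngineAssemblyEntropyTransport

/-!
# The entropy production identity along a hard-sphere flow (helper for the dock of route OneFlightGossipEngine)

Step (i) of the entropy clock, real-valued form, continuing
`Theorems/OneFlightGossipEngineAssemblyEntropyTransport.lean` (transport identity
`klDiv_lawAt_withDensity_eq`): for the hard-sphere law `f dZ` evolved to time `t` and two
references `g₀ dZ` (time `0`) and `g dZ` (time `t`) with a.e. positive finite densities,

  `KL((Φ_t)_* (f dZ) ‖ g dZ) - KL(f dZ ‖ g₀ dZ) = ∫ (log g₀ - log (g ∘ Φ_t)) f dZ + ∫ g dZ - ∫ g₀ dZ`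

(`toReal_klDiv_lawAt_sub`; the mass terms vanish for probability references). In the dock
(Assembly stmt-AtomisticToContinuum-14647 ≡ crux 14680; TwoClocks 13735; Yau 1991, Olla–Varadhan–Yau
1993 §3) `g₀, g` are the local Gibbs densities with the Euler parameters at times `0` and `t`, and the
right-hand side is the expectation under the INITIAL local Gibbs law of an explicit functional of the
trajectory — `log ψ₀(z) - log ψ_t(Φ_t z)` — which the fundamental theorem of calculus along the
piecewise-free trajectory splits into the kinetic streaming terms and the collisional jumps that the
window-LD inputs of the dock consume. Abstract ingredients proved here:
`llr_withDensity_ae_eq` (log-likelihood ratio of `f dL` w.r.t. `g dL` is `log f - log g`) and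
`toReal_klDiv_withDensity` (`KL(f dL ‖ g dL) = ∫ (log f - log g) f dL + ∫ g dL - ∫ f dL`).
-/

noncomputable section

open MeasureTheory InformationTheory Set Filter
open scoped ENNReal

namespace Summit.AtomisticToContinuum.HydrodynamicLimit.Theorems

section Abstract

variable {α : Type*} [MeasurableSpace α]

/-- **Log-likelihood ratio of two laws with densities.** For a σ-finite reference `L` and measurable
densities `f` (a.e. finite) and `g` (a.e. positive and finite), the log-likelihood ratio of `f dL`
with respect to `g dL` is `log f - log g`, `f dL`-almost everywhere. [folklore] -/
theorem llr_withDensity_ae_eq (L : Measure α) [SigmaFinite L] {f g : α → ℝ≥0∞}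
    (hf : Measurable f) (hg : Measurable g) (hf_top : ∀ᵐ x ∂L, f x ≠ ∞)
    (hg0 : ∀ᵐ x ∂L, g x ≠ 0) (hg_top : ∀ᵐ x ∂L, g x ≠ ∞) :
    llr (L.withDensity f) (L.withDensity g) =ᵐ[L.withDensity f]
      fun x => Real.log (f x).toReal - Real.log (g x).toReal := by
  have hσ : SigmaFinite (L.withDensity f) := SigmaFinite.withDensity_of_ne_top hf_top
  have h1 : (L.withDensity f).rnDeriv (L.withDensity g) =ᵐ[L]
      fun x => (g x)⁻¹ * (L.withDensity f).rnDeriv L x :=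
    Measure.rnDeriv_withDensity_right (L.withDensity f) L hg.aemeasurable hg0 hg_top
  have h2 : (L.withDensity f).rnDeriv L =ᵐ[L] f := Measure.rnDeriv_withDensity L hf
  have h3 : ∀ᵐ x ∂L, f x ≠ 0 → llr (L.withDensity f) (L.withDensity g) x =
      Real.log (f x).toReal - Real.log (g x).toReal := by
    filter_upwards [h1, h2, hf_top, hg0, hg_top] with x hx1 hx2 hft hg0' hgt hf0
    rw [llr, hx1, hx2, ENNReal.toReal_mul, ENNReal.toReal_inv]
    have hfpos : 0 < (f x).toReal := ENNReal.toReal_pos hf0 hft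
    have hgpos : 0 < (g x).toReal := ENNReal.toReal_pos hg0' hgt
    rw [inv_mul_eq_div, Real.log_div hfpos.ne' hgpos.ne']
  exact (ae_withDensity_iff hf).2 h3

/-- **Kullback–Leibler divergence of two laws with densities w.r.t. a common reference** (real
form): `KL(f dL ‖ g dL) = ∫ (log f - log g) f dL + ∫ g dL - ∫ f dL` for finite laws, `g` a.e.
positive and finite, provided `log f - log g` is `f dL`-integrable. [folklore] -/
theorem toReal_klDiv_withDensity (L : Measure α) [SigmaFinite L] {f g : α → ℝ≥0∞}
    (hf : Measurable f) (hg : Measurable g) [IsFiniteMeasure (L.withDensity f)]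
    [IsFiniteMeasure (L.withDensity g)] (hg0 : ∀ᵐ x ∂L, g x ≠ 0) (hg_top : ∀ᵐ x ∂L, g x ≠ ∞)
    (hint : Integrable (fun x => Real.log (f x).toReal - Real.log (g x).toReal) (L.withDensity f)) :
    (klDiv (L.withDensity f) (L.withDensity g)).toReal =
      ∫ x, (Real.log (f x).toReal - Real.log (g x).toReal) ∂(L.withDensity f) +
        (L.withDensity g).real univ - (L.withDensity f).real univ := by
  have hlin : ∫⁻ x, f x ∂L ≠ ∞ := by
    rw [← setLIntegral_univ, ← withDensity_apply f MeasurableSet.univ]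
    exact measure_ne_top _ _
  have hf_top : ∀ᵐ x ∂L, f x ≠ ∞ := (ae_lt_top hf hlin).mono fun x hx => hx.ne
  have hac : L.withDensity f ≪ L.withDensity g :=
    (withDensity_absolutelyContinuous L f).trans (withDensity_absolutelyContinuous' hg.aemeasurable hg0)
  have hllr := llr_withDensity_ae_eq L hf hg hf_top hg0 hg_top
  have hint' : Integrable (llr (L.withDensity f) (L.withDensity g)) (L.withDensity f) :=
    hint.congr hllr.symm
  rw [toReal_klDiv hac hint', integral_congr_ae hllr]

end Abstract

section Flow

open Literature.Analysis.FluidPDE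

variable {d : Type*} [Fintype d] {X : Type*} [MeasureSpace X] [TopologicalSpace X] {N : ℕ}
  {G : Geometry d X} {ε : ℝ}

/-- The total mass of `(g ∘ Φ_t) dZ` is that of `g dZ` (Liouville invariance). [folklore] -/
theorem lintegral_comp_flow (Φ : HardSphereFlow G ε N) {g : Config N d X → ℝ≥0∞} (hg : Measurable g)
    (t : ℝ) : ∫⁻ z, g (Φ.flow t z) ∂liouville G N ε = ∫⁻ z, g z ∂liouville G N ε :=
  (Φ.measurePreserving t).lintegral_comp hg

/-- **Entropy production identity along a hard-sphere flow.** For the evolved law `(Φ_t)_* (f dZ)`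
and references `g₀ dZ`, `g dZ` with a.e. positive finite measurable densities (all laws finite) and
the two log-ratios integrable under `f dZ`:
`KL((Φ_t)_* (f dZ) ‖ g dZ) - KL(f dZ ‖ g₀ dZ) = ∫ (log g₀ - log (g ∘ Φ_t)) f dZ + ∫ g dZ - ∫ g₀ dZ`.
[cite: OllaVaradhanYau1993, §3] -/
theorem toReal_klDiv_lawAt_sub (Φ : HardSphereFlow G ε N) [SigmaFinite (liouville G N ε)]
    {f g₀ g : Config N d X → ℝ≥0∞} (hf : Measurable f) (hg₀ : Measurable g₀) (hg : Measurable g)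
    [IsFiniteMeasure ((liouville G N ε).withDensity f)]
    [IsFiniteMeasure ((liouville G N ε).withDensity g₀)]
    [IsFiniteMeasure ((liouville G N ε).withDensity g)]
    (hg₀0 : ∀ᵐ z ∂liouville G N ε, g₀ z ≠ 0) (hg₀top : ∀ᵐ z ∂liouville G N ε, g₀ z ≠ ∞)
    (hg0 : ∀ᵐ z ∂liouville G N ε, g z ≠ 0) (hgtop : ∀ᵐ z ∂liouville G N ε, g z ≠ ∞) (t : ℝ)
    (hint₀ : Integrable (fun z => Real.log (f z).toReal - Real.log (g₀ z).toReal)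
      ((liouville G N ε).withDensity f))
    (hint : Integrable (fun z => Real.log (f z).toReal - Real.log (g (Φ.flow t z)).toReal)
      ((liouville G N ε).withDensity f)) :
    (klDiv (Φ.lawAt ((liouville G N ε).withDensity f) t) ((liouville G N ε).withDensity g)).toReal
      - (klDiv ((liouville G N ε).withDensity f) ((liouville G N ε).withDensity g₀)).toReal
    = ∫ z, (Real.log (g₀ z).toReal - Real.log (g (Φ.flow t z)).toReal)
        ∂((liouville G N ε).withDensity f)
      + ((liouville G N ε).withDensity g).real univ - ((liouville G N ε).withDensity g₀).real univ := by
  have hgt : Measurable fun z => g (Φ.flow t z) := hg.comp (Φ.measurable_flow t)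
  -- the pulled-back reference has the same (finite) mass
  have hmass : ((liouville G N ε).withDensity fun z => g (Φ.flow t z)) univ =
      ((liouville G N ε).withDensity g) univ := by
    rw [withDensity_apply _ MeasurableSet.univ, withDensity_apply _ MeasurableSet.univ,
      Measure.restrict_univ, lintegral_comp_flow Φ hg t]
  haveI : IsFiniteMeasure ((liouville G N ε).withDensity fun z => g (Φ.flow t z)) :=
    ⟨by rw [hmass]; exact measure_lt_top _ _⟩
  -- a.e. positivity/finiteness of the pulled-back density (quasi-measure-preservation of `Φ_t`)
  have hq := (Φ.measurePreserving t).quasiMeasurePreserving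
  have hgt0 : ∀ᵐ z ∂liouville G N ε, g (Φ.flow t z) ≠ 0 := hq.ae hg0
  have hgttop : ∀ᵐ z ∂liouville G N ε, g (Φ.flow t z) ≠ ∞ := hq.ae hgtop
  have hreal : ((liouville G N ε).withDensity fun z => g (Φ.flow t z)).real univ =
      ((liouville G N ε).withDensity g).real univ := by
    rw [measureReal_def, measureReal_def, hmass]
  rw [klDiv_lawAt_withDensity_eq Φ hg t,
    toReal_klDiv_withDensity (liouville G N ε) hf hgt hgt0 hgttop hint,
    toReal_klDiv_withDensity (liouville G N ε) hf hg₀ hg₀0 hg₀top hint₀, hreal]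
  have hsub : ∫ z, (Real.log (g₀ z).toReal - Real.log (g (Φ.flow t z)).toReal)
        ∂((liouville G N ε).withDensity f) =
      ∫ z, (Real.log (f z).toReal - Real.log (g (Φ.flow t z)).toReal)
          ∂((liouville G N ε).withDensity f) -
        ∫ z, (Real.log (f z).toReal - Real.log (g₀ z).toReal)
          ∂((liouville G N ε).withDensity f) := by
    rw [← integral_sub hint hint₀]
    refine integral_congr_ae (Eventually.of_forall fun z => ?_)
    ring
  rw [hsub]
  ring

end Flow

section LocalGibbs

open Literature.Analysis.FluidPDE Literature.MathematicalPhysics.KineticTheory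

/-- The canonical density of a local Gibbs profile is nonnegative. [folklore] -/
theorem canonicalDensity_localGibbsProfile_nonneg {a θ : T3 → ℝ} {u : T3 → V3}
    (ha0 : ∀ x, 0 ≤ a x) (hθ0 : ∀ x, 0 ≤ θ x) (ε : ℝ) (n : ℕ) (z : Config n (Fin 3) T3) :
    0 ≤ canonicalDensity (Torus.geometry (Fin 3)) ε n (localGibbsProfile a u θ) z := by
  unfold canonicalDensity
  refine mul_nonneg (inv_nonneg.2 (canonicalPartition_nonneg _ _ _ fun y =>
    localGibbsProfile_nonneg ha0 hθ0 y)) (Set.indicator_nonneg (fun w _ => ?_) z)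
  exact tensorPow_nonneg (fun y => localGibbsProfile_nonneg ha0 hθ0 y) n w

/-- The canonical density of a local Gibbs profile with continuous positive activity and temperature
is POSITIVE on the hard-sphere domain, at every `N`, for `σ ≤ 1/2` (the partition function is
positive: `posPartition_pos`). [folklore] -/
theorem canonicalDensity_localGibbsProfile_pos {a θ : T3 → ℝ} {u : T3 → V3} (ha : Continuous a)
    (hθ : Continuous θ) (hu : Continuous u) (ha0 : ∀ x, 0 < a x) (hθ0 : ∀ x, 0 < θ x) {σ : ℝ}
    (hσ2 : σ ≤ 1 / 2) (N : ℕ) {z : Config (N + 1) (Fin 3) T3}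
    (hz : z ∈ hardSphereDomain (Torus.geometry (Fin 3)) (N + 1) (hsDiameter σ N)) :
    0 < canonicalDensity (Torus.geometry (Fin 3)) (hsDiameter σ N) (N + 1) (localGibbsProfile a u θ) z := by
  unfold canonicalDensity
  rw [Set.indicator_of_mem hz, canonicalPartition_eq_posPartition ha hθ hu (fun x => (ha0 x).le) hθ0]
  refine mul_pos (inv_pos.2 (posPartition_pos ha ha0 hσ2 N)) ?_
  unfold tensorPow localGibbsProfile
  exact Finset.prod_pos fun i _ => mul_pos (ha0 _) (localMaxwellian_pos one_pos (hθ0 _) _ _)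

/-- Liouville-almost everywhere the local Gibbs canonical density is positive (as an `ℝ≥0∞`
density it is nonzero), for `σ ≤ 1/2`. [folklore] -/
theorem ae_canonicalDensity_localGibbsProfile_ne_zero {a θ : T3 → ℝ} {u : T3 → V3}
    (ha : Continuous a) (hθ : Continuous θ) (hu : Continuous u) (ha0 : ∀ x, 0 < a x)
    (hθ0 : ∀ x, 0 < θ x) {σ : ℝ} (hσ2 : σ ≤ 1 / 2) (N : ℕ) :
    ∀ᵐ z ∂liouville (Torus.geometry (Fin 3)) (N + 1) (hsDiameter σ N),
      ENNReal.ofReal (canonicalDensity (Torus.geometry (Fin 3)) (hsDiameter σ N) (N + 1)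
        (localGibbsProfile a u θ) z) ≠ 0 := by
  rw [liouville_eq]
  filter_upwards [ae_restrict_mem (measurableSet_hardSphereDomain _
    Torus.measurable_geometry_sepVec (N + 1) (hsDiameter σ N))] with z hz
  exact (ENNReal.ofReal_pos.2 (canonicalDensity_localGibbsProfile_pos ha hθ hu ha0 hθ0 hσ2 N hz)).ne'

/-- **The entropy production identity in the dock's currency** (local Gibbs references). For the
hard-sphere system on `𝕋³` at reduced diameter `σ ≤ 1/2` started from the local Gibbs law
`λ_N = localGibbsLaw σ a₀ u₀ θ₀ N Φ` (continuous positive profiles) and two local Gibbs references with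
continuous positive profiles — `ψ₀` with `(b₀, w₀, ϑ₀)` (time `0`) and `ψ` with `(b, w, ϑ)` (time `t`),
writing `ρ_•` for their canonical densities:
`KL(lawAt Φ λ_N t ‖ ψ) - KL(λ_N ‖ ψ₀) = E_{λ_N}[log ρ_{ψ₀}(z) - log ρ_ψ(Φ_t z)]`
(real parts; both references are probability measures so the mass terms cancel), provided the two
log-ratios are `λ_N`-integrable. [cite: Yau1991, §2] -/
theorem toReal_klDiv_lawAt_localGibbsLaw_sub {σ : ℝ} (hσ2 : σ ≤ 1 / 2) {a₀ θ₀ b₀ ϑ₀ b ϑ : T3 → ℝ}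
    {u₀ w₀ w : T3 → V3} (ha : Continuous a₀) (hθ : Continuous θ₀) (hu : Continuous u₀)
    (ha0 : ∀ x, 0 < a₀ x) (hθ0 : ∀ x, 0 < θ₀ x) (hb₀ : Continuous b₀) (hϑ₀ : Continuous ϑ₀)
    (hw₀ : Continuous w₀) (hb₀0 : ∀ x, 0 < b₀ x) (hϑ₀0 : ∀ x, 0 < ϑ₀ x) (hb : Continuous b)
    (hϑ : Continuous ϑ) (hw : Continuous w) (hb0 : ∀ x, 0 < b x) (hϑ0 : ∀ x, 0 < ϑ x) (N : ℕ)
    (Φ : HardSphereFlow (Torus.geometry (Fin 3)) (hsDiameter σ N) (N + 1)) (t : ℝ)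
    (hint₀ : Integrable (fun z =>
        Real.log (canonicalDensity (Torus.geometry (Fin 3)) (hsDiameter σ N) (N + 1)
          (localGibbsProfile a₀ u₀ θ₀) z) -
        Real.log (canonicalDensity (Torus.geometry (Fin 3)) (hsDiameter σ N) (N + 1)
          (localGibbsProfile b₀ w₀ ϑ₀) z)) (localGibbsLaw σ a₀ u₀ θ₀ N Φ))
    (hint : Integrable (fun z =>
        Real.log (canonicalDensity (Torus.geometry (Fin 3)) (hsDiameter σ N) (N + 1)
          (localGibbsProfile a₀ u₀ θ₀) z) -
        Real.log (canonicalDensity (Torus.geometry (Fin 3)) (hsDiameter σ N) (N + 1)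
          (localGibbsProfile b w ϑ) (Φ.flow t z))) (localGibbsLaw σ a₀ u₀ θ₀ N Φ)) :
    (klDiv (Φ.lawAt (localGibbsLaw σ a₀ u₀ θ₀ N Φ) t) (localGibbsLaw σ b w ϑ N Φ)).toReal -
        (klDiv (localGibbsLaw σ a₀ u₀ θ₀ N Φ) (localGibbsLaw σ b₀ w₀ ϑ₀ N Φ)).toReal =
      ∫ z, (Real.log (canonicalDensity (Torus.geometry (Fin 3)) (hsDiameter σ N) (N + 1)
          (localGibbsProfile b₀ w₀ ϑ₀) z) -
        Real.log (canonicalDensity (Torus.geometry (Fin 3)) (hsDiameter σ N) (N + 1)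
          (localGibbsProfile b w ϑ) (Φ.flow t z))) ∂(localGibbsLaw σ a₀ u₀ θ₀ N Φ) := by
  -- σ-finiteness of the Liouville measure (instance path made explicit, cf. `sFinite_localGibbsLaw`)
  haveI hXE : SigmaFinite (volume : Measure (T3 × V3)) := inferInstance
  haveI hC : SigmaFinite (volume : Measure (Config (N + 1) (Fin 3) T3)) := inferInstance
  haveI hL : SigmaFinite (liouville (Torus.geometry (Fin 3)) (N + 1) (hsDiameter σ N)) := by
    rw [liouville_eq]; infer_instance
  -- the three laws as densities w.r.t. the Liouville measure (definitional)
  have hdens : ∀ (a θ : T3 → ℝ) (u : T3 → V3), localGibbsLaw σ a u θ N Φ =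
      (liouville (Torus.geometry (Fin 3)) (N + 1) (hsDiameter σ N)).withDensity fun z =>
        ENNReal.ofReal (canonicalDensity (Torus.geometry (Fin 3)) (hsDiameter σ N) (N + 1)
          (localGibbsProfile a u θ) z) := fun a θ u => rfl
  have hm : ∀ {a θ : T3 → ℝ} {u : T3 → V3}, Continuous a → Continuous θ → Continuous u →
      Measurable fun z => ENNReal.ofReal (canonicalDensity (Torus.geometry (Fin 3)) (hsDiameter σ N)
        (N + 1) (localGibbsProfile a u θ) z) := fun ha hθ hu =>
    (measurable_canonicalDensity _ _ (measurable_localGibbsProfile ha hθ hu)).ennreal_ofReal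
  haveI i₀ : IsProbabilityMeasure (localGibbsLaw σ a₀ u₀ θ₀ N Φ) :=
    isProbabilityMeasure_localGibbsLaw ha hθ hu ha0 hθ0 hσ2 N Φ
  haveI i₁ : IsProbabilityMeasure (localGibbsLaw σ b₀ w₀ ϑ₀ N Φ) :=
    isProbabilityMeasure_localGibbsLaw hb₀ hϑ₀ hw₀ hb₀0 hϑ₀0 hσ2 N Φ
  haveI i₂ : IsProbabilityMeasure (localGibbsLaw σ b w ϑ N Φ) :=
    isProbabilityMeasure_localGibbsLaw hb hϑ hw hb0 hϑ0 hσ2 N Φ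
  haveI j₀ : IsFiniteMeasure ((liouville (Torus.geometry (Fin 3)) (N + 1) (hsDiameter σ N)).withDensity
      fun z => ENNReal.ofReal (canonicalDensity (Torus.geometry (Fin 3)) (hsDiameter σ N) (N + 1)
        (localGibbsProfile a₀ u₀ θ₀) z)) := by rw [← hdens]; infer_instance
  haveI j₁ : IsFiniteMeasure ((liouville (Torus.geometry (Fin 3)) (N + 1) (hsDiameter σ N)).withDensity
      fun z => ENNReal.ofReal (canonicalDensity (Torus.geometry (Fin 3)) (hsDiameter σ N) (N + 1)
        (localGibbsProfile b₀ w₀ ϑ₀) z)) := by rw [← hdens]; infer_instance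
  haveI j₂ : IsFiniteMeasure ((liouville (Torus.geometry (Fin 3)) (N + 1) (hsDiameter σ N)).withDensity
      fun z => ENNReal.ofReal (canonicalDensity (Torus.geometry (Fin 3)) (hsDiameter σ N) (N + 1)
        (localGibbsProfile b w ϑ) z)) := by rw [← hdens]; infer_instance
  -- pointwise `toReal ∘ ofReal = id` on the (nonnegative) densities
  have hto : ∀ {a θ : T3 → ℝ} {u : T3 → V3}, (∀ x, 0 < a x) → (∀ x, 0 < θ x) →
      ∀ z : Config (N + 1) (Fin 3) T3, (ENNReal.ofReal (canonicalDensity (Torus.geometry (Fin 3))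
        (hsDiameter σ N) (N + 1) (localGibbsProfile a u θ) z)).toReal =
        canonicalDensity (Torus.geometry (Fin 3)) (hsDiameter σ N) (N + 1) (localGibbsProfile a u θ) z :=
    fun ha0 hθ0 z => ENNReal.toReal_ofReal (canonicalDensity_localGibbsProfile_nonneg
      (fun x => (ha0 x).le) (fun x => (hθ0 x).le) _ _ _)
  -- the abstract identity
  have key := toReal_klDiv_lawAt_sub Φ (hm ha hθ hu) (hm hb₀ hϑ₀ hw₀) (hm hb hϑ hw)
    (ae_canonicalDensity_localGibbsProfile_ne_zero hb₀ hϑ₀ hw₀ hb₀0 hϑ₀0 hσ2 N)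
    (Eventually.of_forall fun z => ENNReal.ofReal_ne_top)
    (ae_canonicalDensity_localGibbsProfile_ne_zero hb hϑ hw hb0 hϑ0 hσ2 N)
    (Eventually.of_forall fun z => ENNReal.ofReal_ne_top) t
    (by
      rw [← hdens]
      refine hint₀.congr (Eventually.of_forall fun z => ?_)
      simp only [hto ha0 hθ0, hto hb₀0 hϑ₀0])
    (by
      rw [← hdens]
      refine hint.congr (Eventually.of_forall fun z => ?_)
      simp only [hto ha0 hθ0, hto hb0 hϑ0])
  -- rewrite the laws as densities and cancel the unit masses
  rw [← hdens, ← hdens, ← hdens] at key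
  rw [key, probReal_univ, probReal_univ, add_sub_cancel_right]
  refine integral_congr_ae (Eventually.of_forall fun z => ?_)
  simp only [hto hb₀0 hϑ₀0, hto hb0 hϑ0]

end LocalGibbs

end Summit.AtomisticToContinuum.HydrodynamicLimit.Theorems

end
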